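import Summits.AtomisticToContinuum.HydrodynamicLimit.Theorems.JParityClosureEvenStressEnskogTubeStatRegular
import Summits.AtomisticToContinuum.HydrodynamicLimit.Theorems.ImplosionDichotomyHsEosLowDensity
import Summits.AtomisticToContinuum.HydrodynamicLimit.Theses.InformationPercolationEngine
import Literature.MathematicalPhysics.KineticTheory.LinearLorentzBoltzmannProofs
import Literature.MathematicalPhysics.KineticTheory.TaggedLinearBoltzmannSeries
import HarnessLib

/-!
# Regularity of the even tube functional at the speed-truncated CONSTANT mark (mark-1 twin of S6)

Helper for the support item `InformationPercolationEngine.CollisionRate` (stmt-AtomisticToContinuum-13481), which is the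
constant-mark instance `Ξ ≡ 1` of the even collision statistic `evenStat` of crux `JParityClosure.EvenStressEnskog`
(stmt-13079; `Theorems/InformationPercolationEngineCollisionRate.lean`, `collisionRate_iff_evenStat_one`). The chassis of
that crux's line `even-rung-mean-variance` (truncate · tube pull-back · mean · fixed-time variance · Chebyshev ·
regularity) needs, at the mark it runs on, the REGULARITY input S6: joint measurability and a uniform bound of the
fixed-time even tube functional `W_t = evenTubeStat σ N χ g Ξ r κ t`. At the bare constant mark the Enskog side is
velocity-unbounded (`sphereMark 1 v w = π‖v − w‖`), so — exactly as the momentum-transfer marks are truncated to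
`evenMarkTrunc k l L` there — the constant mark is run through the tree's speed cutoff:
`Ξ₁ᴸ(n̂, v, w) = speedCutoff L ‖w − v‖` (`= 1` for relative speed `≤ L`, `= 0` for `≥ 2L`, continuous, values in `[0,1]`).
This file proves the mark-1 twin of the registered stub `stub_evenTubeStatRegular` UNCONDITIONALLY (the equation-of-state
hypothesis `HsEosLowDensity` of the 13079 version is the tree theorem `Theorems.hsEosLowDensity_proof`, stmt-0768):

* `sphereMark_speedCutoff` — `Θ Ξ₁ᴸ (v, w) = ψ_L(‖w − v‖) · ν(w − v)` (`ν = lorentzLossRate`);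
* `abs_sphereMark_speedCutoff_le` — `|Θ Ξ₁ᴸ| ≤ 2L|S²|`;
* `exists_abs_pairFunctional_speedCutoff_le`, `exists_bound_enskogRate_speedCutoff` — uniform bounds of the mollified pair
  functional and of the Enskog rate functional at `Ξ₁ᴸ`;
* `evenTubeStatRegular_one` — MAIN: `∃ η₀ > 0` such that for `σ > 0`, continuous `χ, g` with `g = 0` on `[η₀, ∞)`,
  `L > 0`, `r > 0`, `κ ≥ 0`: `(t, z) ↦ evenTubeStat σ N χ g Ξ₁ᴸ r κ t z` is Borel measurable and bounded on
  `[0, τ] × Config`.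

Everything else is the 13079 machinery verbatim (`Theorems.measurable_tubeStat_uncurry`, `Theorems.exists_bound_tubeStat`,
`EvenStressEnskog.measurable_enskogRate_uncurry`, `EvenStressEnskog.exists_bound_mul_contactValue`).
prover-pitem-stmt-AtomisticToContinuum-13481-2.
-/

noncomputable section

open MeasureTheory Set Filter Topology
open scoped ENNReal InnerProductSpace BigOperators

namespace Summit.AtomisticToContinuum.HydrodynamicLimit.Theorems.CollisionRate

open Literature.Analysis.FluidPDE Literature.MathematicalPhysics.KineticTheory
open Summit.AtomisticToContinuum.HydrodynamicLimit.Theorems.EvenStressEnskog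
  (measurable_enskogRate_uncurry exists_bound_mul_contactValue mollDensity_nonneg abs_coneKernel_le
    pairFunctional_eq_sum)

/-! ## The speed-truncated constant mark `Ξ₁ᴸ(n̂, v, w) = ψ_L(‖w − v‖)` -/

/-- The speed cutoff `ψ_L` is continuous. [folklore] -/
theorem continuous_speedCutoff (L : ℝ) : Continuous (speedCutoff L) := by
  unfold speedCutoff
  fun_prop

/-- The speed-truncated constant mark `(n̂, v, w) ↦ ψ_L(‖w − v‖)` is continuous. [folklore] -/
theorem continuous_speedCutoff_mark (L : ℝ) :
    Continuous fun q : V3 × V3 × V3 => speedCutoff L ‖q.2.2 - q.2.1‖ := by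
  have h : Continuous fun q : V3 × V3 × V3 => ‖q.2.2 - q.2.1‖ := by fun_prop
  exact (continuous_speedCutoff L).comp h

/-- `|ψ_L| ≤ 1`. [folklore] -/
theorem abs_speedCutoff_le_one (L s : ℝ) : |speedCutoff L s| ≤ 1 := by
  have h := speedCutoff_mem_Icc L s
  rw [abs_of_nonneg h.1]
  exact h.2

/-- The speed-truncated constant mark is bounded by `1`. [folklore] -/
theorem exists_abs_speedCutoff_mark_le (L : ℝ) :
    ∃ C : ℝ, ∀ q : V3 × V3 × V3, |speedCutoff L ‖q.2.2 - q.2.1‖| ≤ C :=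
  ⟨1, fun _ => abs_speedCutoff_le_one L _⟩

/-- **`Θ Ξ₁ᴸ (v, w) = ψ_L(‖w − v‖) · ν(w − v)`**: the mark does not depend on the impact direction, so its sphere
integral is the speed cutoff times the loss frequency `ν(w − v) = ∫_{S²}((w − v)·ω)₊ dω`. [folklore] -/
theorem sphereMark_speedCutoff (L : ℝ) (v w : V3) :
    sphereMark (fun q : V3 × V3 × V3 => speedCutoff L ‖q.2.2 - q.2.1‖) v w =
      speedCutoff L ‖w - v‖ * lorentzLossRate (w - v) := by
  unfold sphereMark
  dsimp only
  rw [integral_const_mul, integral_hardSphereKernel]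

/-- **`|Θ Ξ₁ᴸ (v, w)| ≤ 2L · |S²|`**: zero for relative speed `≥ 2L`, and `ν(u) ≤ |S²| ‖u‖` otherwise. [folklore] -/
theorem abs_sphereMark_speedCutoff_le {L : ℝ} (hL : 0 < L) (v w : V3) :
    |sphereMark (fun q : V3 × V3 × V3 => speedCutoff L ‖q.2.2 - q.2.1‖) v w| ≤ 2 * L * sphereMass V3 := by
  rw [sphereMark_speedCutoff]
  by_cases h : 2 * L ≤ ‖w - v‖
  · rw [speedCutoff_eq_zero hL h, zero_mul, abs_zero]
    exact mul_nonneg (by positivity) sphereMass_nonneg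
  · push Not at h
    rw [abs_mul, abs_of_nonneg (lorentzLossRate_nonneg _)]
    calc |speedCutoff L ‖w - v‖| * lorentzLossRate (w - v)
        ≤ 1 * (sphereMass V3 * ‖w - v‖) :=
          mul_le_mul (abs_speedCutoff_le_one L _) (lorentzLossRate_le _) (lorentzLossRate_nonneg _) zero_le_one
      _ ≤ 1 * (sphereMass V3 * (2 * L)) := by
          gcongr
          exact sphereMass_nonneg
      _ = 2 * L * sphereMass V3 := by ring

/-! ## Bounds for the Enskog side at `Ξ₁ᴸ` -/

/-- Uniform bound of the mollified pair functional at the speed-truncated constant mark (finite double sum of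
cone weights `≤ 3/(πr³)` times `|Θ Ξ₁ᴸ| ≤ 2L|S²|`). [folklore] -/
theorem exists_abs_pairFunctional_speedCutoff_le (N : ℕ) {L r : ℝ} (hL : 0 < L) (hr : 0 < r) :
    ∃ CB : ℝ, ∀ (z : Config (N + 1) (Fin 3) T3) (x₀ : UnitAddTorus (Fin 3)),
      |pairFunctional r (fun q : V3 × V3 × V3 => speedCutoff L ‖q.2.2 - q.2.1‖) z x₀| ≤ CB := by
  refine ⟨((N + 1 : ℕ) : ℝ)⁻¹ * ((N + 1 : ℕ) : ℝ)⁻¹ * ((N + 1 : ℝ) ^ 2 *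
    (3 / (Real.pi * r ^ 3) * (3 / (Real.pi * r ^ 3)) * (2 * L * sphereMass V3))), fun z x₀ => ?_⟩
  rw [pairFunctional_eq_sum]
  refine abs_const_mul_sum_sum_le_of (by positivity) _ fun i j => ?_
  rw [abs_mul, abs_mul]
  exact mul_le_mul (mul_le_mul (abs_coneKernel_le hr _ _) (abs_coneKernel_le hr _ _) (abs_nonneg _)
    (by positivity)) (abs_sphereMark_speedCutoff_le hL _ _) (abs_nonneg _) (by positivity)

/-- Uniform bound for the Enskog rate functional at `Ξ₁ᴸ` on `[0, τ] × Config` (as `exists_bound_enskogRate` of the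
13079 line, with the pair-functional bound above). [folklore] -/
theorem exists_bound_enskogRate_speedCutoff {σ : ℝ} (N : ℕ) {χ : ℝ × UnitAddTorus (Fin 3) → ℝ} {g : ℝ → ℝ}
    {L r C : ℝ} (hσ : 0 ≤ σ) (hχ : Continuous χ)
    (hgY : ∀ a, 0 ≤ a → |g a * contactValue a| ≤ C) (hL : 0 < L) (hr : 0 < r) (τ : ℝ) :
    ∃ B : ℝ, ∀ t ∈ Set.Icc (0 : ℝ) τ, ∀ z : Config (N + 1) (Fin 3) T3,
      |enskogRate σ N χ g (fun q : V3 × V3 × V3 => speedCutoff L ‖q.2.2 - q.2.1‖) r t z| ≤ B := by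
  obtain ⟨CB, hCB⟩ := exists_abs_pairFunctional_speedCutoff_le N hL hr
  have hK : IsCompact (Set.Icc (0 : ℝ) τ ×ˢ (univ : Set (UnitAddTorus (Fin 3)))) :=
    isCompact_Icc.prod isCompact_univ
  obtain ⟨Cχ, hCχ⟩ := hK.exists_bound_of_continuousOn hχ.continuousOn
  have hC0 : 0 ≤ C := (abs_nonneg _).trans (hgY 0 le_rfl)
  refine ⟨Cχ * C * CB * (volume : Measure (UnitAddTorus (Fin 3))).real univ, fun t ht z => ?_⟩
  have hCχ0 : 0 ≤ Cχ := (norm_nonneg _).trans (hCχ (t, (z 0).1) ⟨ht, mem_univ _⟩)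
  unfold enskogRate
  have h := norm_integral_le_of_norm_le_const (μ := (volume : Measure (UnitAddTorus (Fin 3))))
    (C := Cχ * C * CB)
    (f := fun x => χ (t, x) * g (σ ^ 3 * mollDensity r z x) *
      contactValue (σ ^ 3 * mollDensity r z x) *
        pairFunctional r (fun q : V3 × V3 × V3 => speedCutoff L ‖q.2.2 - q.2.1‖) z x)
    (Eventually.of_forall fun x => ?_)
  · simpa only [Real.norm_eq_abs] using h
  · rw [Real.norm_eq_abs]
    have hρ : 0 ≤ σ ^ 3 * mollDensity r z x := mul_nonneg (pow_nonneg hσ 3) (mollDensity_nonneg hr z x)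
    have e : χ (t, x) * g (σ ^ 3 * mollDensity r z x) * contactValue (σ ^ 3 * mollDensity r z x) *
          pairFunctional r (fun q : V3 × V3 × V3 => speedCutoff L ‖q.2.2 - q.2.1‖) z x
        = χ (t, x) * (g (σ ^ 3 * mollDensity r z x) * contactValue (σ ^ 3 * mollDensity r z x)) *
          pairFunctional r (fun q : V3 × V3 × V3 => speedCutoff L ‖q.2.2 - q.2.1‖) z x := by ring
    rw [e, abs_mul, abs_mul]
    have hχx : |χ (t, x)| ≤ Cχ := by
      simpa only [Real.norm_eq_abs] using hCχ (t, x) ⟨ht, mem_univ _⟩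
    exact mul_le_mul (mul_le_mul hχx (hgY _ hρ) (abs_nonneg _) hCχ0) (hCB z x) (abs_nonneg _)
      (mul_nonneg hCχ0 hC0)

/-! ## The mark-1 twin of S6, unconditional -/

/-- The equation-of-state support `HsEosLowDensity` of route JParityClosure is the tree theorem
`Theorems.hsEosLowDensity_proof` (stmt-AtomisticToContinuum-0768, stated verbatim in every route that shares it; the two
route decls have the same body). [folklore] -/
theorem hsEosLowDensity_JParityClosure :
    Summit.AtomisticToContinuum.HydrodynamicLimit.Theses.JParityClosure.HsEosLowDensity :=
  Summit.AtomisticToContinuum.HydrodynamicLimit.Theorems.hsEosLowDensity_proof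

/-- The equation-of-state support `HsEosLowDensity` of route InformationPercolationEngine (the same shared item
stmt-AtomisticToContinuum-0768, hypothesis `hE` of that route's `closes`) is likewise the tree theorem
`Theorems.hsEosLowDensity_proof`. [folklore] -/
theorem hsEosLowDensity_InformationPercolationEngine :
    Summit.AtomisticToContinuum.HydrodynamicLimit.Theses.InformationPercolationEngine.HsEosLowDensity :=
  Summit.AtomisticToContinuum.HydrodynamicLimit.Theorems.hsEosLowDensity_proof

/-- **Mark-1 twin of S6 (`stub_evenTubeStatRegular`), UNCONDITIONAL.** There is `η₀ > 0` (half the analyticity radius of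
the hard-sphere excess free energy, from the proved `HsEosLowDensity`) such that for `σ > 0`, continuous `χ, g` with
`g = 0` on `[η₀, ∞)`, `L > 0`, `r > 0`, `κ ≥ 0` and any `τ`: (i) `(t, z) ↦ evenTubeStat σ N χ g Ξ₁ᴸ r κ t z` is Borel
measurable on `ℝ × Config` and (ii) it is bounded uniformly on `[0, τ] × Config`, where `Ξ₁ᴸ(n̂, v, w) = ψ_L(‖w − v‖)`
is the speed-truncated constant mark. [folklore] -/
theorem evenTubeStatRegular_one :
    ∃ η₀ : ℝ, 0 < η₀ ∧ ∀ (σ : ℝ) (N : ℕ) (χ : ℝ × UnitAddTorus (Fin 3) → ℝ) (g : ℝ → ℝ) (L r κ τ : ℝ),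
      0 < σ → Continuous χ → Continuous g → (∀ a, η₀ ≤ a → g a = 0) → 0 < L → 0 < r → 0 ≤ κ →
      Measurable (fun p : ℝ × Config (N + 1) (Fin 3) T3 =>
        evenTubeStat σ N χ g (fun q : V3 × V3 × V3 => speedCutoff L ‖q.2.2 - q.2.1‖) r κ p.1 p.2) ∧
      ∃ B : ℝ, ∀ t ∈ Set.Icc (0 : ℝ) τ, ∀ z : Config (N + 1) (Fin 3) T3,
        |evenTubeStat σ N χ g (fun q : V3 × V3 × V3 => speedCutoff L ‖q.2.2 - q.2.1‖) r κ t z| ≤ B := by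
  obtain ⟨η₀, hη₀, hY⟩ := exists_bound_mul_contactValue hsEosLowDensity_JParityClosure
  refine ⟨η₀, hη₀, fun σ N χ g L r κ τ hσ hχ hg hg0 hL hr hκ => ⟨?_, ?_⟩⟩
  · have hA := measurable_tubeStat_uncurry σ N hχ hg (continuous_speedCutoff_mark L) r r 1 κ
    have hB := measurable_enskogRate_uncurry σ N hχ hg (continuous_speedCutoff_mark L) r
    simp only [evenTubeStat_def]
    exact hA.sub (hB.const_mul _)
  · obtain ⟨C, -, hC⟩ := hY g hg hg0
    obtain ⟨BA, hBA⟩ :=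
      exists_bound_tubeStat σ N hχ hg (exists_abs_speedCutoff_mark_le L) hr r zero_le_one hκ τ
    obtain ⟨BE, hBE⟩ := exists_bound_enskogRate_speedCutoff N hσ.le hχ hC hL hr τ
    refine ⟨BA + σ ^ 3 * BE, fun t ht z => ?_⟩
    rw [evenTubeStat_def]
    calc |tubeStat σ N χ g (fun q : V3 × V3 × V3 => speedCutoff L ‖q.2.2 - q.2.1‖) r r 1 κ t z -
          σ ^ 3 * enskogRate σ N χ g (fun q : V3 × V3 × V3 => speedCutoff L ‖q.2.2 - q.2.1‖) r t z|
        ≤ |tubeStat σ N χ g (fun q : V3 × V3 × V3 => speedCutoff L ‖q.2.2 - q.2.1‖) r r 1 κ t z| +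
          |σ ^ 3 * enskogRate σ N χ g (fun q : V3 × V3 × V3 => speedCutoff L ‖q.2.2 - q.2.1‖) r t z| :=
          abs_sub _ _
      _ = |tubeStat σ N χ g (fun q : V3 × V3 × V3 => speedCutoff L ‖q.2.2 - q.2.1‖) r r 1 κ t z| +
          σ ^ 3 * |enskogRate σ N χ g (fun q : V3 × V3 × V3 => speedCutoff L ‖q.2.2 - q.2.1‖) r t z| := by
          rw [abs_mul, abs_of_nonneg (pow_nonneg hσ.le 3)]
      _ ≤ BA + σ ^ 3 * BE :=
          add_le_add (hBA t ht z) (mul_le_mul_of_nonneg_left (hBE t ht z) (pow_nonneg hσ.le 3))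

end Summit.AtomisticToContinuum.HydrodynamicLimit.Theorems.CollisionRate

end
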